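import Mathlib
import HarnessLib
import Literature.MathematicalPhysics.StatisticalMechanics.WeightTower

/-!
# Strong weights and the subadditivity half of Theorem 7.1 (Adams–Buchholz–Kotecký–Müller,
# (7.6), Lemma 7.6 (ii), Lemma 7.8; Theorem 7.1 (w5), (w6), (w6'), (w9))

Continuation of `WeightTower.lean`.  Besides the weak-norm weights `w_k^X = e^{½(A_k^Xφ,φ)}`,
[ABKM19] uses STRONG-norm weights `W_k^X(φ) = e^{½(G_k^Xφ,φ)}` ((7.6):
`(φ,G_k^Xφ) = h_k^{−2} Σ_{1≤|α|≤⌊d/2⌋+1} L^{2k(|α|−1)} (∇^αφ, 1_X ∇^αφ)`), additive over disjoint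
polymers and dominated by the added forms `δ_k M_k^X` when `h^{−2} < δ` ((7.60)).  For abstract data
(`W : WeightData Λ` and strong forms `G k X`) this file derives from such hypotheses
(`WeightData.StrongDominated`):

* (w5) `strongWeight_union` — `W_k^{X∪Y} = W_k^X W_k^Y` for disjoint `X, Y`;
* Lemma 7.6 (ii) (7.53) `form_add_strong_le_form_union` — `A_k^X + G_k^Y ⪯ A_k^{X∪Y}` for disjoint
  polymers, hence (w6) `weight_mul_strongWeight_le` — `w_k^X W_k^Y ≤ w_k^{X∪Y}`;
* Lemma 7.6 (ii) (7.54) `midForm_add_two_strong_le` — `A_{k:k+1}^X + 2G' ⪯ A_{k+1}^U` whenever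
  `X ⊆ U*` and `2G' ⪯ δ_{k+1}M_{k+1}^U` (in the source `G' = G_k^{U^+}`, (7.62)), hence (w6')
  `midWeight_mul_sq_le_weight_succ` — `w_{k:k+1}^X (W')² ≤ w_{k+1}^U`;
* (w9) `exp_mul_midWeight_le_weight_succ` — `e^{q(φ)/2} w_{k:k+1}^X(φ) ≤ w_{k+1}^X(φ)` whenever
  `X ⊆ X*` and `q(φ) ≤ (φ, δ_{k+1}M_{k+1}^Xφ)` (the field-norm bound of Lemma 7.8, supplied there by
  the discrete Sobolev inequality Lemma 7.9).

Everything is proved; no named fact.  What is NOT here: the concrete `G_k^X`, `M_k^X` of [ABKM19]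
and the Sobolev inequality.

## References
* S. Adams, S. Buchholz, R. Kotecký, S. Müller, arXiv:1910.13564, (7.6), Lemma 7.6 (ii) with
  (7.59)–(7.63), Lemma 7.8, Theorem 7.1 (w5), (w6), (w9) [AdamsBuchholzKoteckyMuller2019].
-/

noncomputable section

open Matrix
open scoped Matrix MatrixOrder

namespace Literature.MathematicalPhysics.StatisticalMechanics.GradientRG

variable {Λ : Type*} [Fintype Λ] [DecidableEq Λ]

/-- The exponential weight of a quadratic form, `e^{½(Aφ,φ)}` (both `w_k^X` and `W_k^X` have this
shape). [cite: AdamsBuchholzKoteckyMuller2019, Ch. 7.1 (7.4), (7.6)] -/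
def expWeight (A : Matrix Λ Λ ℝ) (φ : Λ → ℝ) : ℝ :=
  Real.exp ((1/2 : ℝ) * (φ ⬝ᵥ A *ᵥ φ))

omit [DecidableEq Λ] in
/-- `e^{½((A+B)φ,φ)} = e^{½(Aφ,φ)} e^{½(Bφ,φ)}`. [cite: AdamsBuchholzKoteckyMuller2019, Theorem 7.1 (w5)] -/
theorem expWeight_add (A B : Matrix Λ Λ ℝ) (φ : Λ → ℝ) :
    expWeight (A + B) φ = expWeight A φ * expWeight B φ := by
  rw [expWeight, expWeight, expWeight, Matrix.add_mulVec, dotProduct_add, mul_add, Real.exp_add]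

omit [DecidableEq Λ] in
/-- `A ⪯ B ⇒ e^{½(Aφ,φ)} ≤ e^{½(Bφ,φ)}`. [cite: AdamsBuchholzKoteckyMuller2019, Theorem 7.1 (w1)] -/
theorem expWeight_mono {A B : Matrix Λ Λ ℝ} (hAB : (B - A).PosSemidef) (φ : Λ → ℝ) :
    expWeight A φ ≤ expWeight B φ :=
  WeightData.exp_half_quadForm_le_of_posSemidef_sub hAB φ

omit [DecidableEq Λ] in
/-- `e^{½((2•A)φ,φ)} = (e^{½(Aφ,φ)})²`. [cite: AdamsBuchholzKoteckyMuller2019, Theorem 7.1 (w6)] -/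
theorem expWeight_two_smul (A : Matrix Λ Λ ℝ) (φ : Λ → ℝ) :
    expWeight ((2 : ℝ) • A) φ = expWeight A φ ^ 2 := by
  rw [expWeight, expWeight, Matrix.smul_mulVec, dotProduct_smul, smul_eq_mul, sq, ← Real.exp_add]
  ring_nf

namespace WeightData

variable {W : WeightData Λ}

/-- `w_k^X = expWeight (A_k^X)`. [cite: AdamsBuchholzKoteckyMuller2019, Ch. 7.1 (7.4)] -/
theorem weight_eq_expWeight (k : ℕ) (X : Finset Λ) (φ : Λ → ℝ) :
    W.weight k X φ = expWeight (W.form k X) φ := rfl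

/-- `w_{k:k+1}^X = expWeight (A_{k:k+1}^X)`. [cite: AdamsBuchholzKoteckyMuller2019, Ch. 7.1 (7.4)] -/
theorem midWeight_eq_expWeight (k : ℕ) (X : Finset Λ) (φ : Λ → ℝ) :
    W.midWeight k X φ = expWeight (W.midForm k X) φ := rfl

/-- **Hypotheses on the strong forms** ([ABKM19] (7.6), (7.59)–(7.63), relative to a disjointness
relation `Disj k X Y` on scale-`k` polymers): the seeds and added forms are additive over disjoint
sets ((7.59)), the strong forms `G k X` are symmetric, additive over disjoint sets and dominated —
`G_0^X ⪯ A_0^X`, `G_k^X ⪯ δ_kM_k^X` ((7.60), `h^{−2} < δ`) — and the enlargement is extensive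
(`X ⊆ X*`, (7.63)). [cite: AdamsBuchholzKoteckyMuller2019, Lemma 7.6 (ii)] -/
structure StrongDominated (G : ℕ → Finset Λ → Matrix Λ Λ ℝ)
    (Disj : ℕ → Finset Λ → Finset Λ → Prop) : Prop where
  /-- `A_0^{X∪Y} = A_0^X + A_0^Y` for disjoint `X, Y` -/
  seed_add : ∀ X Y, Disj 0 X Y → W.seed (X ∪ Y) = W.seed X + W.seed Y
  /-- `M_k^{X∪Y} = M_k^X + M_k^Y` for disjoint `X, Y` ((7.59)) -/
  pert_add : ∀ k X Y, Disj k X Y → W.pert k (X ∪ Y) = W.pert k X + W.pert k Y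
  /-- `G_k^X` symmetric -/
  strong_isSymm : ∀ k X, (G k X).IsSymm
  /-- `G_k^{X∪Y} = G_k^X + G_k^Y` for disjoint `X, Y` -/
  strong_add : ∀ k X Y, Disj k X Y → G k (X ∪ Y) = G k X + G k Y
  /-- `G_0^X ⪯ A_0^X` -/
  strong_le_seed : ∀ X, (W.seed X - G 0 X).PosSemidef
  /-- `G_k^X ⪯ δ_kM_k^X` ((7.60)) -/
  strong_le_pert : ∀ k X, (W.pert (k + 1) X - G (k + 1) X).PosSemidef
  /-- `X ⊆ X*` ((7.63)) -/
  subset_enl : ∀ k X, X ⊆ W.enl k X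

/-- **Theorem 7.1 (w5)**: the strong weights factorise over disjoint polymers.
[cite: AdamsBuchholzKoteckyMuller2019, Theorem 7.1 (w5)] -/
theorem strongWeight_union {G : ℕ → Finset Λ → Matrix Λ Λ ℝ}
    {Disj : ℕ → Finset Λ → Finset Λ → Prop} (hG : W.StrongDominated G Disj) {k : ℕ}
    {X Y : Finset Λ} (h : Disj k X Y) (φ : Λ → ℝ) :
    expWeight (G k (X ∪ Y)) φ = expWeight (G k X) φ * expWeight (G k Y) φ := by
  rw [hG.strong_add k X Y h, expWeight_add]

/-- **Lemma 7.6 (ii), (7.53)**: `A_k^X + G_k^Y ⪯ A_k^{X∪Y}` for disjoint polymers.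
[cite: AdamsBuchholzKoteckyMuller2019, Lemma 7.6 (ii) (7.53)] -/
theorem form_add_strong_le_form_union {D : ℕ → Matrix Λ Λ ℝ} (hD : W.Dominated D)
    (hm : W.Monotone) {G : ℕ → Finset Λ → Matrix Λ Λ ℝ} {Disj : ℕ → Finset Λ → Finset Λ → Prop}
    (hG : W.StrongDominated G Disj) :
    ∀ k {X Y : Finset Λ}, Disj k X Y → (W.form k (X ∪ Y) - (W.form k X + G k Y)).PosSemidef := by
  intro k
  cases k with
  | zero =>
    intro X Y h
    have := hG.strong_le_seed Y
    rw [form_zero, form_zero, hG.seed_add X Y h]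
    convert this using 1
    abel
  | succ k =>
    intro X Y h
    -- `A_{k+1}^{X∪Y} = A_{k:k+1}^{(X∪Y)*} + δM^X + δM^Y ⪰ A_{k:k+1}^{X*} + δM^X + G^Y`  ((7.61))
    have h1 := midForm_mono hD hm k (hm.enl_mono (k + 1) X (X ∪ Y) Finset.subset_union_left)
    have h2 := hG.strong_le_pert k Y
    have := h1.add h2
    rw [form_succ, form_succ, hG.pert_add (k + 1) X Y h]
    convert this using 1
    abel

/-- **Theorem 7.1 (w6)**: `w_k^X W_k^Y ≤ w_k^{X∪Y}` for disjoint polymers.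
[cite: AdamsBuchholzKoteckyMuller2019, Theorem 7.1 (w6)] -/
theorem weight_mul_strongWeight_le {D : ℕ → Matrix Λ Λ ℝ} (hD : W.Dominated D) (hm : W.Monotone)
    {G : ℕ → Finset Λ → Matrix Λ Λ ℝ} {Disj : ℕ → Finset Λ → Finset Λ → Prop}
    (hG : W.StrongDominated G Disj) {k : ℕ} {X Y : Finset Λ} (h : Disj k X Y) (φ : Λ → ℝ) :
    W.weight k X φ * expWeight (G k Y) φ ≤ W.weight k (X ∪ Y) φ := by
  rw [weight_eq_expWeight, weight_eq_expWeight, ← expWeight_add]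
  exact expWeight_mono (form_add_strong_le_form_union hD hm hG k h) φ

/-- **Lemma 7.6 (ii), (7.54)**: `A_{k:k+1}^X + 2G' ⪯ A_{k+1}^U` whenever `X ⊆ U*` and
`2G' ⪯ δ_{k+1}M_{k+1}^U` (in the source `U = π(X)`, `G' = G_k^{U^+}`, (7.62)–(7.63)).
[cite: AdamsBuchholzKoteckyMuller2019, Lemma 7.6 (ii) (7.54)] -/
theorem midForm_add_two_strong_le {D : ℕ → Matrix Λ Λ ℝ} (hD : W.Dominated D) (hm : W.Monotone)
    {k : ℕ} {X U : Finset Λ} (hXU : X ⊆ W.enl (k + 1) U) {G' : Matrix Λ Λ ℝ}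
    (hG' : (W.pert (k + 1) U - (2 : ℝ) • G').PosSemidef) :
    (W.form (k + 1) U - (W.midForm k X + (2 : ℝ) • G')).PosSemidef := by
  have := (midForm_mono hD hm k hXU).add hG'
  rw [form_succ]
  convert this using 1
  abel

/-- **Theorem 7.1 (w6')**: `w_{k:k+1}^X · (W')² ≤ w_{k+1}^U` for `X ⊆ U*`, `2G' ⪯ δ_{k+1}M_{k+1}^U`.
[cite: AdamsBuchholzKoteckyMuller2019, Theorem 7.1 (w6)] -/
theorem midWeight_mul_sq_le_weight_succ {D : ℕ → Matrix Λ Λ ℝ} (hD : W.Dominated D)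
    (hm : W.Monotone) {k : ℕ} {X U : Finset Λ} (hXU : X ⊆ W.enl (k + 1) U) {G' : Matrix Λ Λ ℝ}
    (hG' : (W.pert (k + 1) U - (2 : ℝ) • G').PosSemidef) (φ : Λ → ℝ) :
    W.midWeight k X φ * expWeight G' φ ^ 2 ≤ W.weight (k + 1) U φ := by
  rw [midWeight_eq_expWeight, weight_eq_expWeight, ← expWeight_two_smul, ← expWeight_add]
  exact expWeight_mono (midForm_add_two_strong_le hD hm hXU hG') φ

/-- **Theorem 7.1 (w9), from the field-norm bound of Lemma 7.8**: if `X ⊆ X*` and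
`q(φ) ≤ (φ, δ_{k+1}M_{k+1}^X φ)` then `e^{q(φ)/2} w_{k:k+1}^X(φ) ≤ w_{k+1}^X(φ)`.
[cite: AdamsBuchholzKoteckyMuller2019, Theorem 7.1 (w9)] -/
theorem exp_mul_midWeight_le_weight_succ {D : ℕ → Matrix Λ Λ ℝ} (hD : W.Dominated D)
    (hm : W.Monotone) {k : ℕ} {X : Finset Λ} (hX : X ⊆ W.enl (k + 1) X) {q : ℝ} {φ : Λ → ℝ}
    (hq : q ≤ φ ⬝ᵥ W.pert (k + 1) X *ᵥ φ) :
    Real.exp (q / 2) * W.midWeight k X φ ≤ W.weight (k + 1) X φ := by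
  have h1 := (midForm_mono hD hm k hX).dotProduct_mulVec_nonneg φ
  rw [star_trivial, Matrix.sub_mulVec, dotProduct_sub] at h1
  rw [midWeight, weight, ← Real.exp_add, form_succ, Matrix.add_mulVec, dotProduct_add]
  exact Real.exp_le_exp.2 (by linarith)

end WeightData

end Literature.MathematicalPhysics.StatisticalMechanics.GradientRG

end
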